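import Literature.Geometry.Riemannian.DirichletPoincareBall
import Literature.Geometry.Riemannian.DirichletProblemWeak
import Literature.Geometry.Lorentzian.WeakSolutionRegularityLocal
import HarnessLib

/-!
# Harmonic replacement on balls of a complete manifold with `Ric ≥ -(d-1)`

The analytic input of the Cheeger–Colding almost rigidity theory (Cheeger–Colding 1996, §6;
1997, §1–§2; 2000, §1): on a ball `B_r(p)` of a connected complete Riemannian `d`-manifold with
`Ric ≥ -(d-1) g`, every `χ ∈ C^∞(M)` with compactly supported differential (in the applications a
cut-off distance function) has a **harmonic replacement**: a function `v`, `C^∞` and harmonic on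
the open ball, with `v - χ ∈ H¹₀(B_r(p))` in the variational sense — `χ - w = v` a.e. on the ball,
`w ∈ L²` vanishing a.e. off the ball, the `L²` limit of a minimising sequence `vₙ ∈ C_c^∞`
vanishing off the ball whose Dirichlet energies `∫ |d(χ - vₙ)|²` converge to the infimum
(`exists_harmonic_replacement_ball`). Assembly of

* the Friedrichs inequality on balls (`DirichletPoincareBall.lean`, from the segment inequality
  and Bishop–Gromov; the annulus `B_{2r} ∖ B_r` must have positive volume, guaranteed here by a
  point `q` with `d(p, q) = 3r/2`; real-integral form `exists_poincare_const_ball`),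
* Dirichlet's principle on a domain with a Poincaré inequality (`DirichletProblemWeak.lean`),
* interior regularity of weakly harmonic functions on an open set
  (`WeakSolutionRegularityLocal.lean`, Weyl's lemma, local form).

No definitions, no named facts (D-0026). Groundwork for `CheegerColding1997_sphereStability`.

## References

* J. Cheeger, T. H. Colding, Ann. of Math. 144 (1996) 189–237, §6. [CheegerColding1996]
* J. Cheeger, T. H. Colding, J. Differential Geom. 46 (1997) 406–480, §1–§2. [CheegerColding1997]
* D. Gilbarg, N. Trudinger, *Elliptic PDE of second order*, §8.2, Cor. 8.11. [GilbargTrudinger2001]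
-/

noncomputable section

open Bundle Set Function Filter Topology MeasureTheory
open scoped Manifold ContDiff ENNReal NNReal

namespace Literature.Geometry.Riemannian

open Literature.Geometry.Lorentzian
open Literature.Geometry.Lorentzian.PseudoRiemannianMetric

section Replacement

variable {d : ℕ} {M : Type*} [TopologicalSpace M] [ChartedSpace (EuclideanSpace ℝ (Fin d)) M]
  [IsManifold 𝓘(ℝ, EuclideanSpace ℝ (Fin d)) ∞ M] [T2Space M]
  (g : PseudoRiemannianMetric 𝓘(ℝ, EuclideanSpace ℝ (Fin d)) ∞ (EuclideanSpace ℝ (Fin d))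
    (TangentSpace 𝓘(ℝ, EuclideanSpace ℝ (Fin d)) : M → Type _)) [g.HasLeviCivita]
  [CovariantDerivative.ContMDiffCovariantDerivative g.leviCivita 1]
  [CovariantDerivative.ContMDiffCovariantDerivative g.leviCivita ∞]

omit [T2Space M] [g.HasLeviCivita] [CovariantDerivative.ContMDiffCovariantDerivative g.leviCivita 1]
  [CovariantDerivative.ContMDiffCovariantDerivative g.leviCivita ∞] in
/-- `Δ` does not depend on the (propositional) Levi-Civita instance: equal metrics have equal
Laplacians. [folklore] -/
theorem dalembertian_congr_metric
    {g₁ g₂ : PseudoRiemannianMetric 𝓘(ℝ, EuclideanSpace ℝ (Fin d)) ∞ (EuclideanSpace ℝ (Fin d))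
      (TangentSpace 𝓘(ℝ, EuclideanSpace ℝ (Fin d)) : M → Type _)}
    [g₁.HasLeviCivita] [g₂.HasLeviCivita] (h12 : g₁ = g₂) (f : M → ℝ) (x : M) :
    g₁.dalembertian f x = g₂.dalembertian f x := by
  subst h12
  rfl

/-- **The Friedrichs inequality on a ball, real-integral form**: under `Ric ≥ -(d-1) g`
(connected, complete) with a point `q` at distance `3r/2` from `p`, there is `C_P` with
`∫ v² ≤ C_P ∫ |dv|²` for every `v ∈ C_c^∞(M)` vanishing off the open ball `B_r(p)`.
[cite: CheegerColding1996, §2, Remark 2.82] [cite: Buser1982, Lemma 5.1] -/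
theorem exists_poincare_const_ball (hd : 0 < d) [ConnectedSpace M] [T3Space M]
    [SecondCountableTopology M] [MeasurableSpace M] [BorelSpace M] (hg : g.IsRiemannian)
    (hc : IsGeodesicallyComplete g.leviCivita)
    (hRic : ∀ (x : M) (w : TangentSpace 𝓘(ℝ, (EuclideanSpace ℝ (Fin d))) x),
      -((d : ℝ) - 1) * g.val x w w ≤ g.leviCivita.ricci x w w)
    (p : M) {r : ℝ} (hr : 0 < r) {q : M} (hq : g.edist hg p q = ENNReal.ofReal (3 * r / 2)) :
    ∃ CP : ℝ, ∀ v : M → ℝ, ContMDiff 𝓘(ℝ, (EuclideanSpace ℝ (Fin d))) 𝓘(ℝ, ℝ) ∞ v →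
      HasCompactSupport v → (∀ x ∉ {x : M | g.edist hg p x < ENNReal.ofReal r}, v x = 0) →
      ∫ x, v x ^ 2 ∂(riemannianMeasure (I := 𝓘(ℝ, (EuclideanSpace ℝ (Fin d))))
          (g.toContMDiffRiemannianMetric hg)) ≤
        CP * ∫ x, g.gradSq v x ∂(riemannianMeasure (I := 𝓘(ℝ, (EuclideanSpace ℝ (Fin d))))
          (g.toContMDiffRiemannianMetric hg)) := by
  haveI : LocallyCompactSpace M :=
    Manifold.locallyCompact_of_finiteDimensional 𝓘(ℝ, (EuclideanSpace ℝ (Fin d)))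
  haveI : Fact ((1 : ℕ∞ω) ≤ (∞ : ℕ∞ω)) := ⟨by exact_mod_cast le_top⟩
  set h := g.toContMDiffRiemannianMetric hg with hh
  set μ := riemannianMeasure (I := 𝓘(ℝ, (EuclideanSpace ℝ (Fin d)))) h with hμ
  haveI : IsFiniteMeasureOnCompacts μ :=
    ⟨fun K hK ↦ riemannianVolume_lt_top_of_isCompact_holds h le_rfl hK⟩
  -- the Bishop–Gromov ratio `Λ = I(4r)/I(r/2)` about `q`
  set I1 : ℝ≥0∞ := ENNReal.ofReal (∫ t in (0 : ℝ)..(r / 2), Real.sinh t ^ (d - 1)) with hI1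
  set I2 : ℝ≥0∞ := ENNReal.ofReal (∫ t in (0 : ℝ)..(4 * r), Real.sinh t ^ (d - 1)) with hI2
  have hI1pos : I1 ≠ 0 := by
    rw [hI1]
    refine (ENNReal.ofReal_pos.2 ?_).ne'
    refine intervalIntegral.intervalIntegral_pos_of_pos_on
      ((Real.continuous_sinh.pow _).intervalIntegrable _ _) (fun t ht ↦ ?_) (by linarith)
    exact pow_pos (Real.sinh_pos_iff.2 ht.1) _
  have hBG := riemannianMeasure_ball_mul_le_of_ricci_ge_neg g hd hg hc hRic q
    (by linarith : 0 < r / 2) (by linarith : r / 2 ≤ 4 * r)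
  rw [← hh, ← hμ] at hBG
  change μ {y : M | g.edist hg q y < ENNReal.ofReal (4 * r)} * I1 ≤
    μ {y : M | g.edist hg q y < ENNReal.ofReal (r / 2)} * I2 at hBG
  set Λ : ℝ≥0∞ := I2 / I1 with hΛ
  have hΛtop : Λ ≠ ⊤ := ENNReal.div_ne_top ENNReal.ofReal_ne_top hI1pos
  have hΛ' : μ {x : M | g.edist hg q x < ENNReal.ofReal (4 * r)} ≤
      Λ * μ {x : M | g.edist hg q x < ENNReal.ofReal (r / 2)} := by
    have h1 : μ {y : M | g.edist hg q y < ENNReal.ofReal (4 * r)} ≤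
        μ {y : M | g.edist hg q y < ENNReal.ofReal (r / 2)} * I2 / I1 :=
      (ENNReal.le_div_iff_mul_le (Or.inl hI1pos) (Or.inl ENNReal.ofReal_ne_top)).2 hBG
    refine h1.trans (le_of_eq ?_)
    rw [hΛ, mul_div_assoc, mul_comm]
  -- the Friedrichs inequality in `lintegral` form
  set C : ℝ≥0∞ := ENNReal.ofReal (2 * (2 * r)) *
    (ENNReal.ofReal ((2 * Real.cosh (2 * r)) ^ (d - 1)) * ENNReal.ofReal (2 * (2 * r)) * (2 * Λ))
    with hC
  have hCtop : C ≠ ⊤ := by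
    rw [hC]
    refine ENNReal.mul_ne_top ENNReal.ofReal_ne_top (ENNReal.mul_ne_top
      (ENNReal.mul_ne_top ENNReal.ofReal_ne_top ENNReal.ofReal_ne_top)
      (ENNReal.mul_ne_top (by norm_num) hΛtop))
  refine ⟨C.toReal, fun v hv hvc hvU ↦ ?_⟩
  have hsupp : ∀ x, ENNReal.ofReal r ≤ g.edist hg p x → v x = 0 := fun x hx ↦
    hvU x (fun hx' ↦ absurd hx (not_le.2 hx'))
  have key := lintegral_sq_le_mul_lintegral_gradSq_of_support_subset_ball g hd hg hc hRic hv p hr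
    hsupp hq hΛ'
  rw [← hh, ← hμ] at key
  replace key : ∫⁻ x, ENNReal.ofReal (v x ^ 2) ∂μ ≤ C * ∫⁻ y, ENNReal.ofReal (g.gradSq v y) ∂μ := by
    rw [hC, mul_assoc]; exact key
  -- pass to real integrals
  have hv2c : Continuous fun x ↦ v x ^ 2 := hv.continuous.pow 2
  have hv2s : HasCompactSupport fun x ↦ v x ^ 2 :=
    HasCompactSupport.intro hvc fun x hx ↦ by
      rw [image_eq_zero_of_notMem_tsupport hx]; ring
  have hv2i : Integrable (fun x ↦ v x ^ 2) μ := hv2c.integrable_of_hasCompactSupport hv2s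
  have hgc : Continuous (g.gradSq v) := contMDiff_gradSq g hv |>.continuous
  have hgs : HasCompactSupport (g.gradSq v) :=
    HasCompactSupport.intro hvc fun x hx ↦ by
      simp [PseudoRiemannianMetric.gradSq, PseudoRiemannianMetric.innerDual,
        mvfderiv_eq_zero_of_notMem_tsupport hx]
  have hgi : Integrable (g.gradSq v) μ := hgc.integrable_of_hasCompactSupport hgs
  have hg0 : ∀ x, 0 ≤ g.gradSq v x := fun x ↦ g.gradSq_nonneg hg v x
  rw [← ofReal_integral_eq_lintegral_ofReal hv2i (Eventually.of_forall fun x ↦ sq_nonneg (v x)),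
    ← ofReal_integral_eq_lintegral_ofReal hgi (Eventually.of_forall hg0)] at key
  have hI0 : 0 ≤ ∫ x, g.gradSq v x ∂μ := integral_nonneg hg0
  have h2 : ENNReal.ofReal (∫ x, v x ^ 2 ∂μ) ≤ ENNReal.ofReal (C.toReal * ∫ x, g.gradSq v x ∂μ) := by
    refine key.trans (le_of_eq ?_)
    rw [ENNReal.ofReal_mul ENNReal.toReal_nonneg, ENNReal.ofReal_toReal hCtop]
  exact (ENNReal.ofReal_le_ofReal_iff (mul_nonneg ENNReal.toReal_nonneg hI0)).1 h2

/-- **Harmonic replacement on a ball** (the Dirichlet problem `Δ v = 0` in `B_r(p)`, `v = χ` on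
`∂B_r(p)` in the `H¹₀` sense, solved variationally). Let `(M, g)` be a connected complete
Riemannian `d`-manifold (`d ≥ 1`) with `Ric ≥ -(d-1) g`, `χ ∈ C^∞(M)` with `dχ = 0` off a compact
set, `r > 0`, and assume some point `q` has `d(p, q) = 3r/2`. Then there are `v`, `w`, `vₙ`, `m_E`
with: `v` is `C^∞` on the open ball `B = {d(p, ·) < r}` and `Δ_g v = 0` there; `w ∈ L²(dV_g)`,
`w = 0` a.e. off `B`, `χ - w = v` a.e. on `B`; `vₙ ∈ C_c^∞(M)` vanish off `B`, `vₙ → w` in `L²`,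
and the Dirichlet energies `∫ |d(χ - vₙ)|²_g` converge to the infimum `m_E` of the energy over
`C_c^∞` functions vanishing off `B`. [cite: CheegerColding1996, §6]
[cite: GilbargTrudinger2001, §8.2 and Cor. 8.11] -/
theorem exists_harmonic_replacement_ball (hd : 0 < d) [ConnectedSpace M] [T3Space M]
    [SecondCountableTopology M] [MeasurableSpace M] [BorelSpace M] (hg : g.IsRiemannian)
    (hc : IsGeodesicallyComplete g.leviCivita)
    (hRic : ∀ (x : M) (w : TangentSpace 𝓘(ℝ, (EuclideanSpace ℝ (Fin d))) x),
      -((d : ℝ) - 1) * g.val x w w ≤ g.leviCivita.ricci x w w)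
    {χ : M → ℝ} (hχ : ContMDiff 𝓘(ℝ, (EuclideanSpace ℝ (Fin d))) 𝓘(ℝ, ℝ) ∞ χ)
    {K₁ : Set M} (hK₁ : IsCompact K₁)
    (hχK : ∀ x ∉ K₁, mvfderiv 𝓘(ℝ, (EuclideanSpace ℝ (Fin d))) χ x = 0)
    (p : M) {r : ℝ} (hr : 0 < r) {q : M} (hq : g.edist hg p q = ENNReal.ofReal (3 * r / 2)) :
    ∃ (v w : M → ℝ) (vn : ℕ → M → ℝ) (mE : ℝ),
      ContMDiffOn 𝓘(ℝ, (EuclideanSpace ℝ (Fin d))) 𝓘(ℝ, ℝ) ∞ v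
        {x : M | g.edist hg p x < ENNReal.ofReal r} ∧
      (∀ x, g.edist hg p x < ENNReal.ofReal r → g.laplaceBeltrami v x = 0) ∧
      MemLp w 2 (riemannianMeasure (I := 𝓘(ℝ, (EuclideanSpace ℝ (Fin d))))
        (g.toContMDiffRiemannianMetric hg)) ∧
      (∀ᵐ x ∂(riemannianMeasure (I := 𝓘(ℝ, (EuclideanSpace ℝ (Fin d))))
        (g.toContMDiffRiemannianMetric hg)), ENNReal.ofReal r ≤ g.edist hg p x → w x = 0) ∧
      (∀ᵐ x ∂(riemannianMeasure (I := 𝓘(ℝ, (EuclideanSpace ℝ (Fin d))))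
        (g.toContMDiffRiemannianMetric hg)), g.edist hg p x < ENNReal.ofReal r → χ x - w x = v x) ∧
      (∀ n, ContMDiff 𝓘(ℝ, (EuclideanSpace ℝ (Fin d))) 𝓘(ℝ, ℝ) ∞ (vn n)) ∧
      (∀ n, HasCompactSupport (vn n)) ∧
      (∀ n x, ENNReal.ofReal r ≤ g.edist hg p x → vn n x = 0) ∧
      Tendsto (fun n ↦ eLpNorm (vn n - w) 2 (riemannianMeasure (I := 𝓘(ℝ, (EuclideanSpace ℝ (Fin d))))
        (g.toContMDiffRiemannianMetric hg))) atTop (𝓝 0) ∧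
      (∀ u : M → ℝ, ContMDiff 𝓘(ℝ, (EuclideanSpace ℝ (Fin d))) 𝓘(ℝ, ℝ) ∞ u → HasCompactSupport u →
        (∀ x, ENNReal.ofReal r ≤ g.edist hg p x → u x = 0) →
        mE ≤ ∫ x, g.gradSq (χ - u) x ∂(riemannianMeasure (I := 𝓘(ℝ, (EuclideanSpace ℝ (Fin d))))
          (g.toContMDiffRiemannianMetric hg))) ∧
      Tendsto (fun n ↦ ∫ x, g.gradSq (χ - vn n) x
        ∂(riemannianMeasure (I := 𝓘(ℝ, (EuclideanSpace ℝ (Fin d)))) (g.toContMDiffRiemannianMetric hg)))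
        atTop (𝓝 mE) := by
  haveI : LocallyCompactSpace M :=
    Manifold.locallyCompact_of_finiteDimensional 𝓘(ℝ, (EuclideanSpace ℝ (Fin d)))
  haveI : Nontrivial (EuclideanSpace ℝ (Fin d)) := by
    have : 0 < Module.finrank ℝ (EuclideanSpace ℝ (Fin d)) := by
      rw [finrank_euclideanSpace_fin]; exact hd
    exact Module.finrank_pos_iff.1 this
  set h := g.toContMDiffRiemannianMetric hg with hh
  set μ := riemannianMeasure (I := 𝓘(ℝ, (EuclideanSpace ℝ (Fin d)))) h with hμ
  haveI : IsFiniteMeasureOnCompacts μ :=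
    ⟨fun K hK ↦ riemannianVolume_lt_top_of_isCompact_holds h le_rfl hK⟩
  have hOf : ofRiemannian h = g := by ext; rfl
  haveI iLC : (ofRiemannian h).HasLeviCivita := by rw [hOf]; infer_instance
  set U : Set M := {x : M | g.edist hg p x < ENNReal.ofReal r} with hU
  have hρm : Continuous fun x ↦ g.edist hg p x :=
    (PseudoRiemannianMetric.continuous_edist hg).comp (Continuous.prodMk_right p)
  have hUo : IsOpen U := isOpen_lt hρm continuous_const
  have hUc : ∀ x, x ∉ U ↔ ENNReal.ofReal r ≤ g.edist hg p x := fun x ↦ by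
    simp only [hU, mem_setOf_eq, not_lt]
  -- (1) the Poincaré constant
  obtain ⟨CP, hP⟩ := exists_poincare_const_ball g hd hg hc hRic p hr hq
  have hP' : ∀ v : M → ℝ, ContMDiff 𝓘(ℝ, (EuclideanSpace ℝ (Fin d))) 𝓘(ℝ, ℝ) ∞ v →
      HasCompactSupport v → (∀ x ∉ U, v x = 0) →
      ∫ x, v x ^ 2 ∂riemannianMeasure h ≤ CP * ∫ x, (ofRiemannian h).gradSq v x ∂riemannianMeasure h := by
    intro v hv hvc hvU
    rw [hOf]
    exact hP v hv hvc hvU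
  -- (2) Dirichlet's principle
  obtain ⟨w₀, vn, mE, hw₀, hw₀U, hvs, hvc, hvU, hlim₀, hmle, hEv, hweak₀⟩ :=
    exists_weak_dirichlet_solution_of_poincare (I := 𝓘(ℝ, (EuclideanSpace ℝ (Fin d)))) h hχ hK₁ hχK
      hUo.measurableSet hP'
  -- a measurable modification `w` of `w₀`
  set w : M → ℝ := hw₀.1.mk w₀ with hwdef
  have hww₀ : w₀ =ᵐ[μ] w := hw₀.1.ae_eq_mk
  have hwm : Measurable w := hw₀.1.stronglyMeasurable_mk.measurable
  have hw : MemLp w 2 μ := hw₀.ae_eq hww₀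
  have hlim : Tendsto (fun n ↦ eLpNorm (vn n - w) 2 μ) atTop (𝓝 0) := by
    refine hlim₀.congr fun n ↦ eLpNorm_congr_ae ?_
    filter_upwards [hww₀] with x hx
    simp [hx]
  have hwU : ∀ᵐ x ∂μ, x ∉ U → w x = 0 := by
    filter_upwards [hw₀U, hww₀] with x hx hx' hxU
    rw [← hx']; exact hx hxU
  have hweak : ∀ ζ : M → ℝ, ContMDiff 𝓘(ℝ, (EuclideanSpace ℝ (Fin d))) 𝓘(ℝ, ℝ) ∞ ζ →
      HasCompactSupport ζ → tsupport ζ ⊆ U →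
      ∫ x, (χ x - w x) * (ofRiemannian h).dalembertian ζ x ∂μ = 0 := by
    intro ζ hζ hζc hζU
    rw [← hweak₀ ζ hζ hζc (fun x hx ↦ image_eq_zero_of_notMem_tsupport fun h' ↦ hx (hζU h'))]
    refine integral_congr_ae ?_
    filter_upwards [hww₀] with x hx
    rw [hx]
  -- (3) interior regularity on the ball
  have hum : Measurable fun x ↦ χ x - w x := hχ.continuous.measurable.sub hwm
  have huli : LocallyIntegrable (fun x ↦ χ x - w x) μ :=
    (hχ.continuous.locallyIntegrable).sub (hw.locallyIntegrable (by norm_num))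
  obtain ⟨v, hv, hΔ, hae⟩ := exists_contMDiffOn_harmonic_ae_eq_of_weaklyHarmonicOn h hum huli hUo
    hweak
  refine ⟨v, w, vn, mE, hv, fun x hx ↦ ?_, hw, ?_, ?_, hvs, hvc, fun n x hx ↦ hvU n x ((hUc x).2 hx),
    hlim, fun u hu huc huU ↦ ?_, ?_⟩
  · have h1 := hΔ x hx
    rw [dalembertian_congr_metric hOf, ← laplaceBeltrami_eq_dalembertian] at h1
    exact h1
  · filter_upwards [hwU] with x hx hxr using hx ((hUc x).2 hxr)
  · filter_upwards [hae] with x hx hxr using hx hxr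
  · have h1 := hmle u hu huc (fun x hx ↦ huU x ((hUc x).1 hx))
    rw [hOf] at h1
    exact h1
  · have h1 := hEv
    rw [hOf] at h1
    exact h1

end Replacement

end Literature.Geometry.Riemannian

end
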